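import Summits.Schanuel.Schanuel.Theorems.ZilberEacDiagonalCriticalGeneric
import Mathlib.Analysis.Polynomial.Basic
import Mathlib.Algebra.MvPolynomial.Monad
import HarnessLib

/-!
# Genericity of pairs `(a k, T_k)` with `T_k → T∞` super-polynomially fast

Zilber's Exponential-Algebraic Closedness, case ladder (host summit Schanuel, cell `pub-schanuel`,
seat 2, gen 13).  For the critical equivariant base `x₂ = -(x₀ - x₁)² + x₀`
(`ZilberEacEquivariantCriticalExistence`) the diagonal-ray solutions with labels `(p, k)` have
`x₁ - x₀ → 2πik` and `y₂/m → T_k = 2πip·e^{4π²k²}/(1 - e^{4π²k²})`, which converges to `-2πip`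
SUPER-EXPONENTIALLY fast (`T_k + 2πip = 2πip/(1 - e^{4π²k²})`).  THEOREM N₂
(`ZilberEacDiagonalCriticalElimination`) needs the pairs `(2πik, T_k)` to be Zariski-generic in
`ℂ²`; the rotation argument of `ZilberEacDiagonalCriticalGeneric` does not apply (no rotation), but
the fast convergence does:

**`pairs_generic_of_superpoly_limit`.**  Let `a ≠ 0`, `T_k → T∞` with `T_k ≠ T∞` and
`k^N (T_k - T∞) → 0` for every `N`.  Then every nonzero `Q ∈ ℂ[V, T]` has `Q(a k, T_k) ≠ 0` for
arbitrarily large `k`.  Proof: substitute `T = T∞ + S` and expand in `S` over `ℂ[V]`: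
`Q = Σ_{j ≥ j₀} q_j(V) S^j` with `q_{j₀} ≠ 0` (trailing coefficient).  From `Q(ak, T_k) = 0` and
`η_k = T_k - T∞ ≠ 0`: `q_{j₀}(ak) = -Σ_{j>j₀} q_j(ak) η_k^{j-j₀} → 0` (polynomial growth against
super-polynomial decay), while a nonzero polynomial evaluated along `ak → ∞` does not tend to `0`.

HONEST FRAMING: a genericity lemma; `EC(3,2)` OPEN; NOT Schanuel's conjecture; EAC ⇏ SC.
-/

noncomputable section

open Complex MvPolynomial Filter Topology

set_option linter.dupNamespace false

namespace Summit.Schanuel.Schanuel.Theorems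

section SuperpolyPairs

/-- A nonzero polynomial of `ℂ[X]` evaluated along `a k` (`a ≠ 0`, `k → ∞`) does not tend to `0`.
[folklore] -/
theorem not_tendsto_zero_eval_mul_natCast {L : Polynomial ℂ} (hL : L ≠ 0) {a : ℂ} (ha : a ≠ 0) :
    ¬ Tendsto (fun k : ℕ => L.eval (a * k)) atTop (𝓝 0) := by
  intro h
  by_cases hdeg : 0 < L.degree
  · -- `‖L(ak)‖ → ∞`
    have hnorm : Tendsto (fun k : ℕ => ‖a * (k : ℂ)‖) atTop atTop := by
      have : Tendsto (fun k : ℕ => ‖a‖ * (k : ℝ)) atTop atTop :=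
        Tendsto.const_mul_atTop (norm_pos_iff.2 ha) tendsto_natCast_atTop_atTop
      refine this.congr fun k => ?_
      rw [norm_mul, Complex.norm_natCast]
    have htop := L.tendsto_norm_atTop hdeg hnorm
    have h0 : Tendsto (fun k : ℕ => ‖L.eval (a * k)‖) atTop (𝓝 0) := by
      simpa using h.norm
    exact not_tendsto_nhds_of_tendsto_atTop htop 0 h0
  · -- constant polynomial
    push Not at hdeg
    have hC := Polynomial.eq_C_of_degree_le_zero hdeg
    have hc0 : L.coeff 0 ≠ 0 := by
      intro h0; apply hL; rw [hC, h0, map_zero]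
    have hconst : Tendsto (fun _ : ℕ => L.coeff 0) atTop (𝓝 (0 : ℂ)) := by
      refine h.congr fun k => ?_
      conv_lhs => rw [hC]
      rw [Polynomial.eval_C]
    exact hc0 (tendsto_nhds_unique tendsto_const_nhds hconst)

/-- The substitution `T ↦ T∞ + S` and the swap of the two variables:
`(bind₁ σ Q)(s, v) = Q(v, T∞ + s)` for `σ = (X₁, C T∞ + X₀)`. [folklore] -/
theorem eval_bind₁_shiftSwap (Q : MvPolynomial (Fin 2) ℂ) (Tinf s v : ℂ) :
    eval ![s, v] (bind₁ (![X 1, C Tinf + X 0] : Fin 2 → MvPolynomial (Fin 2) ℂ) Q) =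
      eval ![v, Tinf + s] Q := by
  change eval₂Hom (RingHom.id ℂ) _ (bind₁ _ Q) = _
  rw [eval₂Hom_bind₁]
  have e : (fun i => eval₂Hom (RingHom.id ℂ) ![s, v]
      ((![X 1, C Tinf + X 0] : Fin 2 → MvPolynomial (Fin 2) ℂ) i)) = ![v, Tinf + s] := by
    funext i
    fin_cases i <;> simp
  rw [e]
  rfl

/-- The substitution of `eval_bind₁_shiftSwap` is injective. [folklore] -/
theorem bind₁_shiftSwap_ne_zero {Q : MvPolynomial (Fin 2) ℂ} (hQ : Q ≠ 0) (Tinf : ℂ) :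
    bind₁ (![X 1, C Tinf + X 0] : Fin 2 → MvPolynomial (Fin 2) ℂ) Q ≠ 0 := by
  intro h
  apply hQ
  have hinv : bind₁ (![X 1 - C Tinf, X 0] : Fin 2 → MvPolynomial (Fin 2) ℂ)
      (bind₁ (![X 1, C Tinf + X 0] : Fin 2 → MvPolynomial (Fin 2) ℂ) Q) = Q := by
    rw [bind₁_bind₁]
    have e : (fun i => bind₁ (![X 1 - C Tinf, X 0] : Fin 2 → MvPolynomial (Fin 2) ℂ)
        ((![X 1, C Tinf + X 0] : Fin 2 → MvPolynomial (Fin 2) ℂ) i)) = X := by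
      funext i
      fin_cases i <;> simp
    rw [e, bind₁_X_left, AlgHom.id_apply]
  rw [← hinv, h, map_zero]

/-- **Pairs `(ak, T_k)` with `T_k → T∞` super-polynomially fast are Zariski-generic in `ℂ²`.**
See the module docstring. (new) -/
theorem pairs_generic_of_superpoly_limit {a : ℂ} (ha : a ≠ 0) {T : ℕ → ℂ} {Tinf : ℂ}
    (hne : ∀ᶠ k in atTop, T k ≠ Tinf)
    (hdec : ∀ N : ℕ, Tendsto (fun k : ℕ => (k : ℂ) ^ N * (T k - Tinf)) atTop (𝓝 0))
    (Q : MvPolynomial (Fin 2) ℂ) (hQ : Q ≠ 0) (K : ℕ) :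
    ∃ k, K ≤ k ∧ eval ![a * k, T k] Q ≠ 0 := by
  classical
  by_contra hall
  push Not at hall
  -- `Q'(S, V) = Q(V, T∞ + S)`, expanded in `S`
  set Q' := bind₁ (![X 1, C Tinf + X 0] : Fin 2 → MvPolynomial (Fin 2) ℂ) Q with hQ'
  have hQ'0 : Q' ≠ 0 := bind₁_shiftSwap_ne_zero hQ Tinf
  set Pq := finSuccEquiv ℂ 1 Q' with hPq
  have hPq0 : Pq ≠ 0 := fun h => hQ'0 ((finSuccEquiv ℂ 1).injective (by rw [← hPq, h, map_zero]))
  set j₀ := Pq.natTrailingDegree with hj₀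
  set A := Pq.natDegree with hA
  have htrail : Pq.coeff j₀ ≠ 0 := by
    have h := Polynomial.trailingCoeff_nonzero_iff_nonzero.2 hPq0
    rwa [Polynomial.trailingCoeff] at h
  set η : ℕ → ℂ := fun k => T k - Tinf with hη
  have hη0 : Tendsto η atTop (𝓝 0) := by simpa using hdec 0
  -- the relation along `k ≥ K`: `Σ_{j₀ ≤ j ≤ A} q_j(ak) η_k^{j - j₀} = 0` when `η_k ≠ 0`
  have hrel : ∀ᶠ k : ℕ in atTop, ∑ j ∈ Finset.Icc j₀ A,
      eval (fun _ => a * (k : ℂ)) (Pq.coeff j) * η k ^ (j - j₀) = 0 := by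
    filter_upwards [hne, eventually_ge_atTop K] with k hk hkK
    have hηk : η k ≠ 0 := sub_ne_zero.2 hk
    have h0 := hall k hkK
    rw [show T k = Tinf + η k by simp [hη], ← eval_bind₁_shiftSwap, ← hQ', eval_fin_two_eq_sum,
      ← hPq] at h0
    -- restrict the sum to `j₀ ≤ j ≤ A` and factor `η^{j₀}`
    have hsum : ∑ j ∈ Finset.range (A + 1), eval (fun _ => a * k) (Pq.coeff j) * η k ^ j =
        η k ^ j₀ * ∑ j ∈ Finset.Icc j₀ A, eval (fun _ => a * k) (Pq.coeff j) * η k ^ (j - j₀) := by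
      rw [Finset.mul_sum]
      have hsub : Finset.Icc j₀ A ⊆ Finset.range (A + 1) := fun j hj => by
        rw [Finset.mem_Icc] at hj; exact Finset.mem_range.2 (Nat.lt_succ_of_le hj.2)
      rw [← Finset.sum_subset hsub]
      · refine Finset.sum_congr rfl fun j hj => ?_
        rw [Finset.mem_Icc] at hj
        rw [show η k ^ j = η k ^ j₀ * η k ^ (j - j₀) by rw [← pow_add, Nat.add_sub_cancel' hj.1]]
        ring
      · intro j hj hjn
        rw [Finset.mem_Icc, not_and_or, not_le, not_le] at hjn
        rcases hjn with hlt | hgt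
        · rw [hj₀] at hlt
          rw [Polynomial.coeff_eq_zero_of_lt_natTrailingDegree hlt, map_zero, zero_mul]
        · rw [hA] at hgt
          rw [Polynomial.coeff_eq_zero_of_natDegree_lt hgt, map_zero, zero_mul]
    rw [hsum] at h0
    exact (mul_eq_zero.1 h0).resolve_left (pow_ne_zero _ hηk)
  -- every term with `j > j₀` tends to `0`; the `j₀`-term is a nonzero polynomial along `ak`
  have hterm : ∀ j ∈ Finset.Icc j₀ A, j ≠ j₀ → Tendsto (fun k : ℕ =>
      eval (fun _ => a * k) (Pq.coeff j) * η k ^ (j - j₀)) atTop (𝓝 0) := by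
    intro j hj hjne
    rw [Finset.mem_Icc] at hj
    have hjpos : 1 ≤ j - j₀ := by omega
    set Lj : Polynomial ℂ := uniqueAlgEquiv ℂ (Fin 1) (Pq.coeff j) with hLj
    -- `L_j(ak) η^{j-j₀} = Σ_i c_i a^i (k^i η) η^{j-j₀-1}`
    have hexp : ∀ k : ℕ, eval (fun _ => a * (k : ℂ)) (Pq.coeff j) * η k ^ (j - j₀) =
        ∑ i ∈ Finset.range (Lj.natDegree + 1),
          Lj.coeff i * a ^ i * (((k : ℂ) ^ i * η k) * η k ^ (j - j₀ - 1)) := by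
      intro k
      rw [← eval_uniqueAlgEquiv_fin_one, ← hLj, Polynomial.eval_eq_sum_range, Finset.sum_mul]
      refine Finset.sum_congr rfl fun i _ => ?_
      rw [show η k ^ (j - j₀) = η k * η k ^ (j - j₀ - 1) by
        rw [← pow_succ', Nat.sub_add_cancel hjpos], mul_pow]
      ring
    have hlim : Tendsto (fun k : ℕ => ∑ i ∈ Finset.range (Lj.natDegree + 1),
        Lj.coeff i * a ^ i * (((k : ℂ) ^ i * η k) * η k ^ (j - j₀ - 1))) atTop
        (𝓝 (∑ i ∈ Finset.range (Lj.natDegree + 1), Lj.coeff i * a ^ i * (0 * 0 ^ (j - j₀ - 1)))) := by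
      refine tendsto_finsetSum _ fun i _ => tendsto_const_nhds.mul ((hdec i).mul (hη0.pow _))
    simp only [zero_mul, mul_zero, Finset.sum_const_zero] at hlim
    exact hlim.congr fun k => (hexp k).symm
  have hj₀mem : j₀ ∈ Finset.Icc j₀ A :=
    Finset.mem_Icc.2 ⟨le_rfl, by rw [hj₀, hA]; exact Polynomial.natTrailingDegree_le_natDegree _⟩
  have hrest : Tendsto (fun k : ℕ => ∑ j ∈ (Finset.Icc j₀ A).erase j₀,
      eval (fun _ => a * k) (Pq.coeff j) * η k ^ (j - j₀)) atTop (𝓝 0) := by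
    have h := tendsto_finsetSum ((Finset.Icc j₀ A).erase j₀) (fun j hj =>
      hterm j (Finset.mem_of_mem_erase hj) (Finset.ne_of_mem_erase hj))
    simpa using h
  have hmain : Tendsto (fun k : ℕ => eval (fun _ => a * (k : ℂ)) (Pq.coeff j₀)) atTop (𝓝 0) := by
    have hneg := hrest.neg
    rw [neg_zero] at hneg
    refine hneg.congr' ?_
    filter_upwards [hrel] with k hk
    rw [← Finset.add_sum_erase _ _ hj₀mem] at hk
    simp only [Nat.sub_self, pow_zero, mul_one] at hk
    linear_combination (-1 : ℂ) * hk
  set L0 : Polynomial ℂ := uniqueAlgEquiv ℂ (Fin 1) (Pq.coeff j₀) with hL0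
  have hL00 : L0 ≠ 0 := fun h =>
    htrail ((uniqueAlgEquiv ℂ (Fin 1)).injective (by rw [← hL0, h, map_zero]))
  refine not_tendsto_zero_eval_mul_natCast hL00 ha (hmain.congr fun k => ?_)
  rw [hL0, eval_uniqueAlgEquiv_fin_one]

end SuperpolyPairs

end Summit.Schanuel.Schanuel.Theorems

end
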